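import Summits.ResolutionOfSingularities.ResolutionOfSingularities.Theorems.FrobeniusClosingSteerFreeChainCoordinates
import Literature.AlgebraicGeometry.Resolution.RegularSystemOfParameters
import HarnessLib

/-!
# Crux `Steer` (stmt-ResolutionOfSingularities-16345), chain W4.1, Lemma S kernel `…NoSatelliteStep`, stage (W) — WINDOW COORDINATES
# at a rational SATELLITE step (ring level)

OURS (campaign `res-hironaka`, rung L ★L-G4, slot W4.1; seat res-L0-w41-stub-2 g6 = Lemma S heir by res-L0-w41-plan-1 RULINGs 163a/181c; spec =
res-D-pv-007's `D/res-D-pv-007/NoSatelliteStep-PLAN.md` stage (W) + res-L0-w41-idea-3 `NT-DIRECT.md` §1 + res-L0-w41-tri-2 `ls/audit_LS.md`; replaces the role of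
no printed item; NOT a statement of the manuscript under review [claim: Hironaka2017, status: under-review]; AI-produced). Theses-free, definition-free.

Window `S₀ ≤ S₁ ≤ S₂` of local subrings of a field, two quadratic transforms in the charts `𝔪₀·S₁ = (x₀)`, `𝔪₁·S₂ = (x₁)` with RATIONAL centres
(`hrat₀`, `hrat₁`), `S₀` regular of dimension `m + 2`, and the SATELLITE hypothesis `(x₀) ≠ (x₁)` in `S₂`. Then (`NoSatelliteWindow.exists_window`) there are
regular systems of parameters
  `𝔪₀ = (X, Y, Y_k)`, `𝔪₁ = (X, y, z_k)`, `𝔪₂ = (x′, y, w_k)`  (`k < m`)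
with the MONOMIAL relations `Y = X·y`, `Y_k = X·z_k` (first step in the `X`-chart), `X = x′·y`, `z_k = w_k·y` (second step in the `y`-chart, the centre ON
the strict transform of `E₀ = V(X)`), and `x₀ = X·u₀`, `x₁ = y·v` with units `u₀, v`. Built from `FreeChain.exists_generator_eq_span` /
`FreeChain.exists_generators_of_rational_step` (p540237) twice, with the rational lifts taken in `S₀` and the two re-normalisations `Y ↦ Y − aX`,
`z ↦ z − b y` of the PLAN (W2)/(W3). [folklore]
-/

noncomputable section

set_option linter.dupNamespace false

open IsLocalRing Literature.AlgebraicGeometry.Resolution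

namespace Summit.ResolutionOfSingularities.ResolutionOfSingularities.Theorems.SwitchingDichotomy.NoSatelliteWindow

variable {L : Type} [Field L]

/-- Re-indexing a family around a chosen index. [folklore] -/
theorem range_eq_insert_range_succAbove {α : Type*} {n : ℕ} (f : Fin (n + 1) → α) (j : Fin (n + 1)) :
    Set.range f = insert (f j) (Set.range (f ∘ j.succAbove)) := by
  rw [Set.range_comp, Fin.range_succAbove, Set.insert_image_compl_eq_range]

/-- In a local subring of a field, `(a) = (b)` forces `b = a · u` for a unit `u`. [folklore] -/
theorem exists_isUnit_eq_mul_of_span_eq {S : Subring L} {a b : S} (h : Ideal.span {b} = Ideal.span {a}) :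
    ∃ u : S, IsUnit u ∧ b = a * u := by
  obtain ⟨u, hu⟩ := (Ideal.span_singleton_eq_span_singleton.mp h.symm)
  exact ⟨u, u.isUnit, hu.symm⟩

/-- `1 − (non-unit)` is a unit in a local ring, so `(x') = (x' · (1 − n))`. [folklore] -/
theorem span_singleton_mul_one_sub_eq {R : Type*} [CommRing R] [IsLocalRing R] (x' n : R) (hn : n ∈ maximalIdeal R) :
    Ideal.span {x' * (1 - n)} = Ideal.span {x'} := by
  rw [mul_comm]
  exact Ideal.span_singleton_mul_left_unit (IsLocalRing.isUnit_one_sub_self_of_mem_nonunits n hn) x'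

/-- **Window coordinates at a rational satellite step.** See the module docstring. [folklore] -/
theorem exists_window {m : ℕ} {S₀ S₁ S₂ : Subring L} [IsLocalRing S₀] [IsLocalRing S₁] [IsLocalRing S₂]
    (h₀₁ : S₀ ≤ S₁) (h₁₂ : S₁ ≤ S₂) (hreg₀ : IsRegularLocalRing S₀) (hdim₀ : ringKrullDim S₀ = (m + 2 : ℕ))
    (hqt₀ : IsQuadraticTransform S₀ S₁) (hqt₁ : IsQuadraticTransform S₁ S₂) (x₀ : S₁) (x₁ : S₂)
    (hx₀ : (maximalIdeal S₀).map (Subring.inclusion h₀₁) = Ideal.span {x₀})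
    (hx₁ : (maximalIdeal S₁).map (Subring.inclusion h₁₂) = Ideal.span {x₁})
    (hrat₀ : ∀ z : S₁, ∃ s : S₀, z - Subring.inclusion h₀₁ s ∈ maximalIdeal S₁)
    (hrat₁ : ∀ z : S₂, ∃ s : S₁, z - Subring.inclusion h₁₂ s ∈ maximalIdeal S₂)
    (hsat : Ideal.span {Subring.inclusion h₁₂ x₀} ≠ Ideal.span {x₁}) :
    ∃ (X Y : S₀) (Yk : Fin m → S₀) (y : S₁) (z : Fin m → S₁) (x' : S₂) (w : Fin m → S₂) (u₀ : S₁) (v : S₂),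
      IsUnit u₀ ∧ IsUnit v ∧ x₀ = Subring.inclusion h₀₁ X * u₀ ∧ x₁ = Subring.inclusion h₁₂ y * v ∧
      Ideal.span (Set.range (Fin.cons X (Fin.cons Y Yk) : Fin (m + 2) → S₀)) = maximalIdeal S₀ ∧
      Ideal.span (Set.range (Fin.cons (Subring.inclusion h₀₁ X) (Fin.cons y z) : Fin (m + 2) → S₁)) = maximalIdeal S₁ ∧
      Ideal.span (Set.range (Fin.cons x' (Fin.cons (Subring.inclusion h₁₂ y) w) : Fin (m + 2) → S₂)) = maximalIdeal S₂ ∧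
      Subring.inclusion h₀₁ Y = Subring.inclusion h₀₁ X * y ∧ (∀ k, Subring.inclusion h₀₁ (Yk k) = Subring.inclusion h₀₁ X * z k) ∧
      Subring.inclusion h₁₂ (Subring.inclusion h₀₁ X) = x' * Subring.inclusion h₁₂ y ∧
      (∀ k, Subring.inclusion h₁₂ (z k) = w k * Subring.inclusion h₁₂ y) := by
  classical
  haveI := hreg₀
  have hdom₀ : SubringDominates S₀ S₁ := hqt₀.dominates
  have hdom₁ : SubringDominates S₁ S₂ := hqt₁.dominates
  -- ### (W1) an rsop of `S₀` whose member `X` generates `𝔪₀ · S₁`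
  have hfin0 : (maximalIdeal S₀).spanFinrank = m + 2 := by
    have h := IsRegularLocalRing.spanFinrank_maximalIdeal (R := S₀)
    rw [hdim₀] at h
    exact_mod_cast h
  obtain ⟨v₀', hv₀'⟩ := exists_regularSystemOfParameters (R := S₀)
  let v₀ : Fin (m + 2) → S₀ := fun i => v₀' (Fin.cast hfin0.symm i)
  have hv₀ : Ideal.span (Set.range v₀) = maximalIdeal S₀ := by
    rw [← hv₀']; congr 1; ext s; constructor
    · rintro ⟨i, rfl⟩; exact ⟨_, rfl⟩
    · rintro ⟨j, rfl⟩; exact ⟨Fin.cast hfin0 j, by simp [v₀]⟩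
  obtain ⟨k₀, hk₀⟩ := FreeChain.exists_generator_eq_span h₀₁ v₀ hv₀ x₀ hx₀
  let X : S₀ := v₀ k₀
  let w0 : Fin (m + 1) → S₀ := v₀ ∘ k₀.succAbove
  have hgen0 : Ideal.span (insert X (Set.range w0)) = maximalIdeal S₀ := by
    rw [← hv₀, range_eq_insert_range_succAbove v₀ k₀]
  have hu0 : (maximalIdeal S₀).map (Subring.inclusion h₀₁) = Ideal.span {Subring.inclusion h₀₁ X} := hx₀.trans hk₀
  -- ### (W2) the first step in the `X`-chart, lifts in `S₀`, re-normalised to `Y0 i = X · t' i`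
  have hrat₀' : ∀ z : S₁, ∃ s ∈ (Set.univ : Set S₀), z - Subring.inclusion h₀₁ s ∈ maximalIdeal S₁ := fun z => by
    obtain ⟨s, hs⟩ := hrat₀ z; exact ⟨s, Set.mem_univ _, hs⟩
  obtain ⟨a, t', -, hrel₀, hgen1⟩ := FreeChain.exists_generators_of_rational_step hqt₀ h₀₁ X w0 hgen0 hu0 Set.univ hrat₀'
  let Y0 : Fin (m + 1) → S₀ := fun i => w0 i - a i * X
  have hY0 : ∀ i, Subring.inclusion h₀₁ (Y0 i) = Subring.inclusion h₀₁ X * t' i := fun i => Subtype.ext (by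
    change ((w0 i - a i * X : S₀) : L) = (X : L) * (t' i : L)
    push_cast
    rw [hrel₀ i]; ring)
  have hgen0' : Ideal.span (insert X (Set.range Y0)) = maximalIdeal S₀ := by
    rw [← hgen0]
    refine FreeChain.span_insert_eq_of_sub_mem X Y0 w0 fun i => ?_
    change w0 i - a i * X - w0 i ∈ _
    rw [sub_sub_cancel_left, neg_mem_iff]
    exact Ideal.mul_mem_left _ _ (Ideal.mem_span_singleton_self X)
  -- ### (W1) at the second step: which generator of `𝔪₁ = (X, t')` generates `𝔪₁ · S₂`? Not `X` (satellite).
  obtain ⟨k₁, hk₁⟩ := FreeChain.exists_generator_eq_span h₁₂ (Fin.cons (Subring.inclusion h₀₁ X) t') (by rw [Fin.range_cons]; exact hgen1) x₁ hx₁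
  have hXx₀ : Ideal.span {Subring.inclusion h₁₂ x₀} = Ideal.span {Subring.inclusion h₁₂ (Subring.inclusion h₀₁ X)} := by
    have := congrArg (Ideal.map (Subring.inclusion h₁₂)) hk₀
    rwa [Ideal.map_span, Ideal.map_span, Set.image_singleton, Set.image_singleton] at this
  have hk₁0 : k₁ ≠ 0 := by
    rintro rfl
    apply hsat
    rw [hXx₀, hk₁, Fin.cons_zero]
  obtain ⟨j, rfl⟩ := Fin.exists_succ_eq.mpr hk₁0
  rw [Fin.cons_succ] at hk₁
  -- `y := t' j`, `z0 := t' off j`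
  let z0 : Fin m → S₁ := t' ∘ j.succAbove
  have hgen1' : Ideal.span (insert (t' j) (Set.range (Fin.cons (Subring.inclusion h₀₁ X) z0 : Fin (m + 1) → S₁))) = maximalIdeal S₁ := by
    rw [← hgen1, range_eq_insert_range_succAbove t' j, Fin.range_cons, Set.insert_comm]
  have hu1 : (maximalIdeal S₁).map (Subring.inclusion h₁₂) = Ideal.span {Subring.inclusion h₁₂ (t' j)} := hx₁.trans hk₁
  -- ### (W3) the second step in the `y`-chart, lifts in the image of `S₀`, re-normalised
  have hratA : ∀ t : S₂, ∃ s ∈ Set.range (Subring.inclusion h₀₁), t - Subring.inclusion h₁₂ s ∈ maximalIdeal S₂ := by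
    intro t
    obtain ⟨s₁, hs₁⟩ := hrat₁ t
    obtain ⟨s₀, hs₀⟩ := hrat₀ s₁
    refine ⟨Subring.inclusion h₀₁ s₀, ⟨s₀, rfl⟩, ?_⟩
    have h2 : Subring.inclusion h₁₂ (s₁ - Subring.inclusion h₀₁ s₀) ∈ maximalIdeal S₂ := FreeChain.inclusion_mem_maximalIdeal hdom₁ hs₀
    rw [map_sub] at h2
    have := Ideal.add_mem _ hs₁ h2
    rwa [sub_add_sub_cancel] at this
  obtain ⟨α, w', hαA, hrel₁, hgen2⟩ :=
    FreeChain.exists_generators_of_rational_step hqt₁ h₁₂ (t' j) (Fin.cons (Subring.inclusion h₀₁ X) z0) hgen1' hu1 _ hratA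
  choose b hb using hαA
  -- the new first parameter `x' = X / y` of `S₂`
  let x' : S₂ := Subring.inclusion h₁₂ (α 0) + w' 0
  have hXrel : Subring.inclusion h₁₂ (Subring.inclusion h₀₁ X) = x' * Subring.inclusion h₁₂ (t' j) := Subtype.ext (by
    have h := hrel₁ 0
    rw [Fin.cons_zero] at h
    change (X : L) = (((α 0 : S₁) : L) + (w' 0 : L)) * (t' j : L)
    rw [Subring.coe_inclusion] at h
    rw [h]; ring)
  have hx'mem : x' ∈ maximalIdeal S₂ := by
    by_contra hunit
    rw [IsLocalRing.mem_maximalIdeal, mem_nonunits_iff, not_not] at hunit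
    apply hsat
    rw [hXx₀, hk₁, hXrel]
    exact Ideal.span_singleton_mul_left_unit hunit _
  have hw'0 : w' 0 ∈ maximalIdeal S₂ := hgen2 ▸ Ideal.subset_span (Set.mem_insert_of_mem _ ⟨0, rfl⟩)
  -- `α 0` is the image of an element of `𝔪₀ ⊆ X · S₁`: `α 0 = X · β`, so `x' · (1 − y β) = w' 0`
  have hα0m : Subring.inclusion h₁₂ (α 0) ∈ maximalIdeal S₂ := by
    have : Subring.inclusion h₁₂ (α 0) = x' - w' 0 := (add_sub_cancel_right _ _).symm
    rw [this]; exact Ideal.sub_mem _ hx'mem hw'0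
  have hb0 : b 0 ∈ maximalIdeal S₀ := by
    have h := hα0m
    rw [← hb 0] at h
    exact FreeChain.mem_maximalIdeal_of_inclusion_mem h₀₁ (FreeChain.mem_maximalIdeal_of_inclusion_mem h₁₂ h)
  obtain ⟨β, hβ⟩ := Ideal.mem_span_singleton'.mp (hu0 ▸ Ideal.mem_map_of_mem (Subring.inclusion h₀₁) hb0)
  have hx'w : x' * (1 - Subring.inclusion h₁₂ (t' j) * Subring.inclusion h₁₂ β) = w' 0 := by
    have : Subring.inclusion h₁₂ (α 0) = x' * Subring.inclusion h₁₂ (t' j) * Subring.inclusion h₁₂ β := by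
      rw [← hb 0, ← hβ, map_mul, hXrel]; ring
    rw [mul_sub, mul_one, ← mul_assoc, ← this]
    exact sub_eq_of_eq_add (add_comm _ _)
  have hx'span : Ideal.span {x'} = Ideal.span {w' 0} := by
    rw [← hx'w, span_singleton_mul_one_sub_eq]
    exact Ideal.mul_mem_right _ _ (FreeChain.inclusion_mem_maximalIdeal hdom₁
      (hgen1' ▸ Ideal.subset_span (Set.mem_insert _ _)))
  -- re-normalised `z_k := z0_k − b_{k+1} · y ∈ S₁` and `Y_k := Y0 (off j) − b_{k+1} · Y ∈ S₀`
  let z : Fin m → S₁ := fun k => z0 k - Subring.inclusion h₀₁ (b k.succ) * t' j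
  let w : Fin m → S₂ := fun k => w' k.succ
  have hzrel : ∀ k, Subring.inclusion h₁₂ (z k) = w k * Subring.inclusion h₁₂ (t' j) := fun k => Subtype.ext (by
    have h := hrel₁ k.succ
    rw [Fin.cons_succ] at h
    change ((z0 k - Subring.inclusion h₀₁ (b k.succ) * t' j : S₁) : L) = (w' k.succ : L) * (t' j : L)
    change ((z0 k : S₁) : L) = _ at h
    push_cast
    rw [h, ← hb k.succ]; ring)
  let Yk : Fin m → S₀ := fun k => Y0 (j.succAbove k) - b k.succ * Y0 j
  have hYrel : Subring.inclusion h₀₁ (Y0 j) = Subring.inclusion h₀₁ X * t' j := hY0 j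
  have hYkrel : ∀ k, Subring.inclusion h₀₁ (Yk k) = Subring.inclusion h₀₁ X * z k := fun k => by
    change Subring.inclusion h₀₁ (Y0 (j.succAbove k) - b k.succ * Y0 j) =
      Subring.inclusion h₀₁ X * (t' (j.succAbove k) - Subring.inclusion h₀₁ (b k.succ) * t' j)
    rw [map_sub, map_mul, hY0, hY0]; ring
  obtain ⟨u₀, hu₀, hxu₀⟩ := exists_isUnit_eq_mul_of_span_eq hk₀
  obtain ⟨v, hv, hxv⟩ := exists_isUnit_eq_mul_of_span_eq hk₁
  refine ⟨X, Y0 j, Yk, t' j, z, x', w, u₀, v, hu₀, hv, hxu₀, hxv, ?_, ?_, ?_, hYrel, hYkrel, hXrel, hzrel⟩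
  · -- `𝔪₀ = (X, Y, Y_k)`
    have hdiff : ∀ i, (Fin.cons X Yk : Fin (m + 1) → S₀) i - (Fin.cons X (Y0 ∘ j.succAbove) : Fin (m + 1) → S₀) i ∈ Ideal.span {Y0 j} := by
      intro i; refine Fin.cases ?_ (fun k => ?_) i
      · rw [Fin.cons_zero, Fin.cons_zero, sub_self]; exact zero_mem _
      · rw [Fin.cons_succ, Fin.cons_succ, Function.comp_apply]
        change Y0 (j.succAbove k) - b k.succ * Y0 j - Y0 (j.succAbove k) ∈ _
        rw [sub_sub_cancel_left, neg_mem_iff]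
        exact Ideal.mul_mem_left _ _ (Ideal.mem_span_singleton_self _)
    rw [Fin.range_cons, Fin.range_cons, Set.insert_comm, ← Fin.range_cons X Yk, FreeChain.span_insert_eq_of_sub_mem (Y0 j) _ _ hdiff,
      Fin.range_cons, Set.insert_comm, ← range_eq_insert_range_succAbove Y0 j, hgen0']
  · -- `𝔪₁ = (X, y, z_k)`
    have hdiff : ∀ i, (Fin.cons (Subring.inclusion h₀₁ X) z : Fin (m + 1) → S₁) i -
        (Fin.cons (Subring.inclusion h₀₁ X) z0 : Fin (m + 1) → S₁) i ∈ Ideal.span {t' j} := by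
      intro i; refine Fin.cases ?_ (fun k => ?_) i
      · rw [Fin.cons_zero, Fin.cons_zero, sub_self]; exact zero_mem _
      · rw [Fin.cons_succ, Fin.cons_succ]
        change z0 k - Subring.inclusion h₀₁ (b k.succ) * t' j - z0 k ∈ _
        rw [sub_sub_cancel_left, neg_mem_iff]
        exact Ideal.mul_mem_left _ _ (Ideal.mem_span_singleton_self _)
    rw [Fin.range_cons, Fin.range_cons, Set.insert_comm, ← Fin.range_cons (Subring.inclusion h₀₁ X) z,
      FreeChain.span_insert_eq_of_sub_mem (t' j) _ _ hdiff, hgen1']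
  · -- `𝔪₂ = (x', y, w_k)`
    rw [Fin.range_cons, Fin.range_cons, Ideal.span_insert, hx'span, ← Ideal.span_insert, Set.insert_comm, ← hgen2,
      range_eq_insert_range_succAbove w' 0]
    congr 3

end Summit.ResolutionOfSingularities.ResolutionOfSingularities.Theorems.SwitchingDichotomy.NoSatelliteWindow

end
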